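import Summits.ResolutionOfSingularities.ResolutionOfSingularities.Theorems.HomologicalConductorNoZenoSplitCountFlatBaseChange
import Summits.ResolutionOfSingularities.ResolutionOfSingularities.Theorems.HomologicalConductorNoZenoSpecResidueField
import HarnessLib

/-!
# Crux `NoZenoR` (stmt-ResolutionOfSingularities-19943), slot `stub_L1wCoreF3`, seam3 — BC-2 FOR A LOCAL HOMOMORPHISM WITH
# FINITE SEPARABLE RESIDUE EXTENSION (`N^s(X ×_S S_f → Spec S_f) = N^s(X → Spec S)`, no finiteness / quasi-finiteness of `S → S_f`)

Route `ResolutionOfSingularities/HomologicalConductor`, crux chain W4.4.  OURS (cell res-hironaka; planner res-L0-w44-plan-1 RULING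
(ρ53f)/(ERRATUM) «(BC-2-fl) → o5», second half: discharge of the closed-fibre HEIGHT CLAUSE and of the finiteness of the fibres of
`pullback.fst` left by signature in `…NoZenoSplitCountFlatBaseChange`); AI-written, weaker than expert review; nothing of the manuscript
under review (Hironaka 2017) is used and no Theses declaration is asserted.  Def-free, `--supports 19943 --as helper`.

THE PROBE.  For a local ring map `S → S_f` whose composite `S → S_f → κ(S_f)` is FINITE (i.e. `κ(S_f)/κ(S)` finite) and
`ρ : Y → Spec S`, the closed fibre of `Y_f := Y ×_S Spec S_f → Spec S_f` is reached by the closed immersion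
`j : F := Y_f ×_{S_f} Spec κ(S_f) → Y_f`, and `j ≫ fst : F → Y` is the base change of the FINITE `Spec κ(S_f) → Spec S`
(pasting of pullback squares), hence finite.  Heights are invariant under finite morphisms (res-D-pv-045 `height_apply_eq`), so
`height (fst ζ) = height ζ` on the closed fibre, and the fibres of `fst` over points of the closed fibre of `ρ` are finite.

* `isFinite_specMap_residue`, `closedPoint_mem_range_specMap_residue` — the probe `Spec κ(S_f) → Spec S_f`;
* `isPullback_probe` — the pasted square; `isFinite_probe_comp_fst`;
* **`height_fst_eq_of_finite_residueField`** — the height clause `hht` of `splitExcCount_pullback_snd_of_height`;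
* **`finite_preimage_fst_singleton_of_finite_residueField`** — finite fibres of `fst` over the closed fibre;
* `splitExcCount_pullback_snd_of_height_of_fibres` — p546424/p574003's count proof with the fibre finiteness BY HYPOTHESIS
  (no `LocallyQuasiFinite`);
* **`splitExcCount_pullback_snd_local`**, `excCurvePoints_pullback_snd_local`, `excCurvePoints_pullback_snd_local_finite` — BC-2 for
  `g = Spec (S → S_f)` LOCAL with `𝔪_S S_f = 𝔪_{S_f}`, `κ(S_f)/κ(S)` finite separable, finitely many honest-weight curves downstairs;
  `finite_residue_comp_algebraMap` (ring-level input).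

References: J. Lipman, Publ. Math. IHÉS 36 (1969), Lemma (16.1) (p. 231) [`Lipman1969`] (context).
-/

noncomputable section

-- single-problem summit: the doubled namespace component `ResolutionOfSingularities` is forced
set_option linter.dupNamespace false

namespace Summit.ResolutionOfSingularities.ResolutionOfSingularities.Theorems.NoZeno.ExcCount

open CategoryTheory CategoryTheory.Limits AlgebraicGeometry IsLocalRing Topology
open Literature.AlgebraicGeometry.Resolution

/-! ## The count proof with the fibre finiteness by hypothesis -/

section Fibres

variable {R RB : Type} [CommRing R] [IsLocalRing R] [CommRing RB] [IsLocalRing RB]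
  {X : Scheme.{0}} (π : X ⟶ Spec (.of R)) (g : Spec (.of RB) ⟶ Spec (.of R))
  (hg : g.base ⁻¹' {closedPoint R} = {closedPoint RB})
  (hht : ∀ ζ : ↑(pullback π g), (pullback.snd π g).base ζ = closedPoint RB →
    Order.height ((pullback.fst π g).base ζ) = Order.height ζ)
  (hfib : ∀ η ∈ excCurvePoints π, ((pullback.fst π g).base ⁻¹' {η}).Finite)

include hg hht hfib in
/-- `splitExcCount_pullback_snd_of_height` with the finiteness of the fibres of `pullback.fst` over the exceptional curves taken
as a HYPOTHESIS `hfib` instead of `[LocallyQuasiFinite g] [QuasiCompact g]` (same proof, p546424 verbatim). [this work] -/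
theorem splitExcCount_pullback_snd_of_height_of_fibres
    (hfin : letI := (g.residueFieldMap (closedPoint RB)).hom.toAlgebra
      Module.Finite ((Spec (.of R)).residueField (g.base (closedPoint RB)))
        ((Spec (.of RB)).residueField (closedPoint RB)))
    (hsep : letI := (g.residueFieldMap (closedPoint RB)).hom.toAlgebra
      Algebra.IsSeparable ((Spec (.of R)).residueField (g.base (closedPoint RB)))
        ((Spec (.of RB)).residueField (closedPoint RB)))
    (hfinπ : (excCurvePoints π).Finite)
    (hFW : ∀ η ∈ excCurvePoints π, letI := (π.residueFieldMap η).hom.toAlgebra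
      FiniteDimensional ((Spec (.of R)).residueField (π.base η))
        (separableClosure ((Spec (.of R)).residueField (π.base η)) (X.residueField η))) :
    splitExcCount (pullback.snd π g) = splitExcCount π := by
  unfold splitExcCount
  rw [excCurvePoints_pullback_snd_of_height π g hg hht, ← Set.biUnion_preimage_singleton]
  rw [finsum_mem_biUnion ?_ hfinπ fun η hη => hfib η hη]
  · refine finsum_mem_congr rfl fun η hη => ?_
    exact finsum_splitWeight_preimage_fst π g hg η hη.1 hfin hsep (hFW η hη)
  · intro η _ η' _ hne
    refine Set.disjoint_left.mpr fun ζ h1 h2 => hne ?_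
    exact h1.symm.trans h2

include hg hht hfib in
/-- Finitely many exceptional curves upstairs, from `hfib`. [this work] -/
theorem excCurvePoints_pullback_snd_finite_of_fibres (hfinπ : (excCurvePoints π).Finite) :
    (excCurvePoints (pullback.snd π g)).Finite := by
  rw [excCurvePoints_pullback_snd_of_height π g hg hht, ← Set.biUnion_preimage_singleton]
  exact hfinπ.biUnion fun η hη => hfib η hη

end Fibres

/-! ## The probe `Spec κ(S_f) → Spec S_f → Spec S` and the closed fibre of `Y ×_S S_f` -/

section Probe

variable {S Sf : Type} [CommRing S] [CommRing Sf] [IsLocalRing Sf] [Algebra S Sf]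
  {Y : Scheme.{0}} (ρ : Y ⟶ Spec (.of S))

/-- `Spec κ(S_f) → Spec S_f` is finite. [folklore] -/
theorem isFinite_specMap_residue : IsFinite (Spec.map (CommRingCat.ofHom (residue Sf))) := by
  rw [IsFinite.SpecMap_iff]
  exact RingHom.Finite.of_surjective _ residue_surjective

/-- The closed point of `Spec S_f` is in the range of `Spec κ(S_f) → Spec S_f`. [folklore] -/
theorem closedPoint_mem_range_specMap_residue :
    closedPoint Sf ∈ Set.range (Spec.map (CommRingCat.ofHom (residue Sf))).base :=
  ⟨closedPoint _, IsLocalRing.comap_closedPoint (residue Sf)⟩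

/-- `Spec κ(S_f) → Spec S` is finite when `S → κ(S_f)` is. [folklore] -/
theorem isFinite_specMap_residue_comp (hκ : ((residue Sf).comp (algebraMap S Sf)).Finite) :
    IsFinite (Spec.map (CommRingCat.ofHom (residue Sf)) ≫ Spec.map (CommRingCat.ofHom (algebraMap S Sf))) := by
  rw [← Spec.map_comp, ← CommRingCat.ofHom_comp, IsFinite.SpecMap_iff]
  exact hκ

/-- The ring-level input: `S → κ(S_f)` is finite when `S → S_f` is local and `κ(S_f)/κ(S)` is finite. [folklore] -/
theorem finite_residue_comp_algebraMap [IsLocalRing S] [IsLocalHom (algebraMap S Sf)]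
    [Module.Finite (ResidueField S) (ResidueField Sf)] :
    ((residue Sf).comp (algebraMap S Sf)).Finite := by
  have h : (residue Sf).comp (algebraMap S Sf) =
      (algebraMap (ResidueField S) (ResidueField Sf)).comp (residue S) := RingHom.ext fun _ => rfl
  rw [h]
  exact (RingHom.finite_algebraMap.mpr inferInstance).comp (RingHom.Finite.of_surjective _ residue_surjective)

/-- **The pasted square**: `F := Y_f ×_{S_f} Spec κ(S_f)` with `j ≫ fst : F → Y` is the base change of `Spec κ(S_f) → Spec S`
along `ρ`. [folklore] -/
theorem isPullback_probe :
    IsPullback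
      (pullback.fst (pullback.snd ρ (Spec.map (CommRingCat.ofHom (algebraMap S Sf))))
          (Spec.map (CommRingCat.ofHom (residue Sf))) ≫
        pullback.fst ρ (Spec.map (CommRingCat.ofHom (algebraMap S Sf))))
      (pullback.snd (pullback.snd ρ (Spec.map (CommRingCat.ofHom (algebraMap S Sf))))
        (Spec.map (CommRingCat.ofHom (residue Sf))))
      ρ (Spec.map (CommRingCat.ofHom (residue Sf)) ≫ Spec.map (CommRingCat.ofHom (algebraMap S Sf))) :=
  IsPullback.paste_horiz (IsPullback.of_hasPullback _ _) (IsPullback.of_hasPullback _ _)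

/-- `j ≫ fst : F → Y` is finite when `S → κ(S_f)` is. [folklore] -/
theorem isFinite_probe_comp_fst (hκ : ((residue Sf).comp (algebraMap S Sf)).Finite) :
    IsFinite (pullback.fst (pullback.snd ρ (Spec.map (CommRingCat.ofHom (algebraMap S Sf))))
          (Spec.map (CommRingCat.ofHom (residue Sf))) ≫
        pullback.fst ρ (Spec.map (CommRingCat.ofHom (algebraMap S Sf)))) :=
  MorphismProperty.of_isPullback (P := @IsFinite) (isPullback_probe ρ).flip (isFinite_specMap_residue_comp hκ)

/-- `j : F → Y_f` is finite (base change of `Spec κ(S_f) → Spec S_f`). [folklore] -/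
theorem isFinite_probe :
    IsFinite (pullback.fst (pullback.snd ρ (Spec.map (CommRingCat.ofHom (algebraMap S Sf))))
      (Spec.map (CommRingCat.ofHom (residue Sf)))) :=
  haveI := isFinite_specMap_residue (Sf := Sf)
  MorphismProperty.pullback_fst _ _ inferInstance

/-- Every point of `Y_f` over the closed point of `S_f` is in the range of `j`. [folklore] -/
theorem mem_range_probe_of_snd_eq (ζ : ↑(pullback ρ (Spec.map (CommRingCat.ofHom (algebraMap S Sf)))))
    (hζ : (pullback.snd ρ (Spec.map (CommRingCat.ofHom (algebraMap S Sf)))).base ζ = closedPoint Sf) :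
    ζ ∈ Set.range (pullback.fst (pullback.snd ρ (Spec.map (CommRingCat.ofHom (algebraMap S Sf))))
      (Spec.map (CommRingCat.ofHom (residue Sf)))).base := by
  rw [Scheme.Pullback.range_fst]
  show (pullback.snd ρ (Spec.map (CommRingCat.ofHom (algebraMap S Sf)))).base ζ ∈
    Set.range (Spec.map (CommRingCat.ofHom (residue Sf))).base
  rw [hζ]
  exact closedPoint_mem_range_specMap_residue

/-- **THE HEIGHT CLAUSE.**  For `S → S_f` with `S → κ(S_f)` finite and any `ρ : Y → Spec S`, the first projection
`Y ×_S Spec S_f → Y` preserves the heights of the points over the closed point of `S_f`. [this work] -/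
theorem height_fst_eq_of_finite_residueField (hκ : ((residue Sf).comp (algebraMap S Sf)).Finite)
    (ζ : ↑(pullback ρ (Spec.map (CommRingCat.ofHom (algebraMap S Sf)))))
    (hζ : (pullback.snd ρ (Spec.map (CommRingCat.ofHom (algebraMap S Sf)))).base ζ = closedPoint Sf) :
    Order.height ((pullback.fst ρ (Spec.map (CommRingCat.ofHom (algebraMap S Sf)))).base ζ) = Order.height ζ := by
  haveI := isFinite_probe_comp_fst ρ hκ
  haveI := isFinite_probe (Sf := Sf) ρ
  obtain ⟨z, rfl⟩ := mem_range_probe_of_snd_eq ρ ζ hζ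
  rw [← Scheme.Hom.comp_apply, height_apply_eq, height_apply_eq]

/-- **FINITE FIBRES OF `fst` OVER THE CLOSED FIBRE.**  For `S → S_f` with `S → κ(S_f)` finite and `g⁻¹{𝔪_S} = {𝔪_{S_f}}`, the
fibre of `Y ×_S Spec S_f → Y` over a point of the closed fibre of `ρ` is finite. [this work] -/
theorem finite_preimage_fst_singleton_of_finite_residueField [IsLocalRing S]
    (hκ : ((residue Sf).comp (algebraMap S Sf)).Finite)
    (hg : (Spec.map (CommRingCat.ofHom (algebraMap S Sf))).base ⁻¹' {closedPoint S} = {closedPoint Sf})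
    {η : Y} (hη : ρ.base η = closedPoint S) :
    ((pullback.fst ρ (Spec.map (CommRingCat.ofHom (algebraMap S Sf)))).base ⁻¹' {η}).Finite := by
  haveI := isFinite_probe_comp_fst ρ hκ
  refine (((pullback.fst (pullback.snd ρ (Spec.map (CommRingCat.ofHom (algebraMap S Sf))))
      (Spec.map (CommRingCat.ofHom (residue Sf))) ≫
    pullback.fst ρ (Spec.map (CommRingCat.ofHom (algebraMap S Sf)))).finite_preimage_singleton η).image
      (pullback.fst (pullback.snd ρ (Spec.map (CommRingCat.ofHom (algebraMap S Sf))))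
        (Spec.map (CommRingCat.ofHom (residue Sf)))).base).subset fun ζ hζ => ?_
  have hζ' : (pullback.fst ρ (Spec.map (CommRingCat.ofHom (algebraMap S Sf)))).base ζ = η := hζ
  have hsnd : (pullback.snd ρ (Spec.map (CommRingCat.ofHom (algebraMap S Sf)))).base ζ = closedPoint Sf := by
    have h1 : (Spec.map (CommRingCat.ofHom (algebraMap S Sf))).base
        ((pullback.snd ρ (Spec.map (CommRingCat.ofHom (algebraMap S Sf)))).base ζ) = closedPoint S := by
      rw [← Scheme.Hom.comp_apply, ← pullback.condition, Scheme.Hom.comp_apply, hζ', hη]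
    have h2 : (pullback.snd ρ (Spec.map (CommRingCat.ofHom (algebraMap S Sf)))).base ζ ∈
        (Spec.map (CommRingCat.ofHom (algebraMap S Sf))).base ⁻¹' {closedPoint S} := h1
    rw [hg] at h2
    exact h2
  obtain ⟨z, rfl⟩ := mem_range_probe_of_snd_eq ρ ζ hsnd
  refine ⟨z, ?_, rfl⟩
  show _ ∈ ({η} : Set Y)
  rw [Scheme.Hom.comp_apply]
  exact hζ

end Probe

/-! ## BC-2 for a local homomorphism with finite separable residue extension -/

section Local

variable {S Sf : Type} [CommRing S] [IsLocalRing S] [CommRing Sf] [IsLocalRing Sf] [Algebra S Sf]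
  [IsLocalHom (algebraMap S Sf)] (hm : (maximalIdeal S).map (algebraMap S Sf) = maximalIdeal Sf)
  [Module.Finite (ResidueField S) (ResidueField Sf)]
  {Y : Scheme.{0}} (ρ : Y ⟶ Spec (.of S))

include hm in
/-- BC-2a for a local `g = Spec (S → S_f)` with `𝔪_S S_f = 𝔪_{S_f}` and `κ(S_f)/κ(S)` finite:
`excCurvePoints (ρ ×_S S_f) = fst⁻¹ (excCurvePoints ρ)`. [this work] -/
theorem excCurvePoints_pullback_snd_local :
    excCurvePoints (pullback.snd ρ (Spec.map (CommRingCat.ofHom (algebraMap S Sf)))) =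
      (pullback.fst ρ (Spec.map (CommRingCat.ofHom (algebraMap S Sf)))).base ⁻¹' excCurvePoints ρ :=
  excCurvePoints_pullback_snd_of_height ρ _ (preimage_closedPoint_eq_of_map_maximalIdeal S Sf hm)
    (height_fst_eq_of_finite_residueField ρ finite_residue_comp_algebraMap)

include hm in
/-- Finitely many exceptional curves upstairs. [this work] -/
theorem excCurvePoints_pullback_snd_local_finite (hfinπ : (excCurvePoints ρ).Finite) :
    (excCurvePoints (pullback.snd ρ (Spec.map (CommRingCat.ofHom (algebraMap S Sf))))).Finite :=
  excCurvePoints_pullback_snd_finite_of_fibres ρ _ (preimage_closedPoint_eq_of_map_maximalIdeal S Sf hm)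
    (height_fst_eq_of_finite_residueField ρ finite_residue_comp_algebraMap)
    (fun _ hη => finite_preimage_fst_singleton_of_finite_residueField ρ finite_residue_comp_algebraMap
      (preimage_closedPoint_eq_of_map_maximalIdeal S Sf hm) hη.1) hfinπ

include hm in
/-- **BC-2 FOR A LOCAL HOMOMORPHISM** `S → S_f` with `𝔪_S S_f = 𝔪_{S_f}` and `κ(S_f)/κ(S)` finite separable: if `ρ : Y → Spec S`
has finitely many integral exceptional curves, all of finite (honest) split weight, then
**`splitExcCount (ρ ×_S S_f) = splitExcCount ρ`**.  No finiteness, flatness or quasi-finiteness of `S → S_f` is used.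
[this work] -/
theorem splitExcCount_pullback_snd_local [Algebra.IsSeparable (ResidueField S) (ResidueField Sf)]
    (hfinπ : (excCurvePoints ρ).Finite)
    (hFW : ∀ η ∈ excCurvePoints ρ, letI := (ρ.residueFieldMap η).hom.toAlgebra
      FiniteDimensional ((Spec (.of S)).residueField (ρ.base η))
        (separableClosure ((Spec (.of S)).residueField (ρ.base η)) (Y.residueField η))) :
    splitExcCount (pullback.snd ρ (Spec.map (CommRingCat.ofHom (algebraMap S Sf)))) = splitExcCount ρ :=
  splitExcCount_pullback_snd_of_height_of_fibres ρ _ (preimage_closedPoint_eq_of_map_maximalIdeal S Sf hm)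
    (height_fst_eq_of_finite_residueField ρ finite_residue_comp_algebraMap)
    (fun _ hη => finite_preimage_fst_singleton_of_finite_residueField ρ finite_residue_comp_algebraMap
      (preimage_closedPoint_eq_of_map_maximalIdeal S Sf hm) hη.1)
    (finite_residueFieldMap_closedPoint S Sf) (isSeparable_residueFieldMap_closedPoint S Sf) hfinπ hFW

end Local

end Summit.ResolutionOfSingularities.ResolutionOfSingularities.Theorems.NoZeno.ExcCount

end
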